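import Literature.Claims.NS.Li2013b
import Literature.Analysis.FluidPDE.SteadyGalerkinApprox
import Literature.Analysis.FluidPDE.DuchonRobertLionsCounterexample
import Literature.Analysis.FunctionSpaces.TorusFourierSynthesis
import Literature.Analysis.FunctionSpaces.TorusClassicalNSGluing
import Literature.Analysis.FunctionSpaces.TorusInverseLaplacian
import HarnessLib

/-!
# C24 `Li2013b` — kernel facts for the NS-claims sweep (D-0090), refuter-8

Typed record: `Literature.Claims.NS.Li2013b` (typist-9, p471752), J. Li, *A proof of the global
regularity for the periodic Navier–Stokes on a unit box*, arXiv:1310.8031v1 (2013), Lemma 6 pp. 8–9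
under the data class (38) p. 7, `‖u₀‖_m ≤ K₃ < ∞ for any m ∈ N⁺` with the paper's norm (6)
`‖u‖_m = (2π)^m (∑_k |k|^{2m} |û_k|²)^{1/2}` on the unit box `Ω = (0,1)³` with zero space average (2).

Kernel facts (all sorry-free, standard axioms):

* `not_Delta4` — the bridge from Lemma 6's data class (38) to the abstract's sentence («the periodic
  3D Navier-Stokes equations with any smooth initial condition», p. 1) is FALSE as typed: the smooth,
  divergence-free, zero-mean shear mode `u₀ = (cos 2πx₂, 0, 0)` has `‖u₀‖_m² ≥ (2π)^{2m}/4`, which is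
  unbounded in `m`, so it lies in NO class (38).
* `dataClass38_eq_zero` — on zero-mean fields the class (38) is `{0}`: for a nonzero mode `k`,
  `(2π)^{2m} |û_k|² ≤ ‖u₀‖_m² ≤ K₃²` for every `m` forces `û_k = 0`; the zero mode is the mean.
* `claimedTheorem_holds` — consequently Lemma 6 as printed (the typist's `ClaimedTheorem`) is TRUE
  for the trivial reason: the only admissible datum is `u₀ = 0`, solved by the zero flow.

So the printed theorem is vacuous (its hypothesis (38) admits only the zero datum) and the abstract's
extension to all smooth data is not supplied by it (`not_Delta4`).

WHAT THIS IS NOT: not a claim about NS regularity or blow-up; not a claim about any author beyond the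
typed locator.
-/

set_option linter.dupNamespace false

noncomputable section

open MeasureTheory Set UnitAddTorus
open Literature.Analysis.FunctionSpaces Literature.Analysis.FunctionSpaces.Torus
open Literature.Analysis.FunctionSpaces.EuclideanSpace (complexify)
open Literature.Claims.NS.Li2013b
open scoped ENNReal NNReal

namespace Summit.NavierStokesRegularity.NavierStokesRegularity.Theorems.Li2013b

/-! ## A single Fourier mode is dominated by the homogeneous Sobolev seminorm -/

/-- One term of the defining series is below `|f|_{Ḣˢ}²`: for `k ≠ 0`,
`|k|^{2s} ‖f̂(k)‖² ≤ eHomSobolevSeminorm s f ^ 2`. [folklore] -/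
theorem term_le_eHomSobolevSeminorm_sq (s : ℝ)
    (f : UnitAddTorus (Fin 3) → EuclideanSpace ℂ (Fin 3)) {k : Fin 3 → ℤ} (hk : k ≠ 0) :
    ENNReal.ofReal (freqNormSq k ^ s) * ‖mFourierCoeff f k‖ₑ ^ 2 ≤ eHomSobolevSeminorm s f ^ 2 := by
  have hsq : eHomSobolevSeminorm s f ^ 2 =
      ∑' k : Fin 3 → ℤ, (if k = 0 then 0 else ENNReal.ofReal (freqNormSq k ^ s)) *
        ‖mFourierCoeff f k‖ₑ ^ 2 := by
    unfold eHomSobolevSeminorm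
    rw [← ENNReal.rpow_natCast, ← ENNReal.rpow_mul]
    norm_num
  rw [hsq]
  have h := ENNReal.le_tsum
    (f := fun k : Fin 3 → ℤ => (if k = 0 then 0 else ENNReal.ofReal (freqNormSq k ^ s)) *
      ‖mFourierCoeff f k‖ₑ ^ 2) k
  simpa [hk] using h

/-! ## The witness against the Δ4 bridge: the shear mode `(cos 2πx₂, 0, 0)` -/

/-- The frequency `e₂ = (0, 1, 0) ∈ ℤ³`. -/
def kmode : Fin 3 → ℤ := Pi.single 1 1

/-- The symmetric frequency set `{e₂, −e₂}`. -/
def Smode : Finset (Fin 3 → ℤ) := {kmode, -kmode}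

/-- The (real, constant) coefficient family `k ↦ (1/2, 0, 0)`. -/
def cmode : (Fin 3 → ℤ) → EuclideanSpace ℂ (Fin 3) :=
  fun _ => complexify (EuclideanSpace.single 0 (1 / 2 : ℝ))

/-- The shear mode `u₀(x) = (cos 2πx₂, 0, 0) = Re ∑_{k = ±e₂} (1/2, 0, 0) e^{2πi k·x}`. -/
def shearMode : UnitAddTorus (Fin 3) → EuclideanSpace ℝ (Fin 3) := realTrigPoly Smode cmode

/-- `e₂ ≠ 0`. -/
theorem kmode_ne_zero : kmode ≠ 0 := by
  intro h
  have h1 := congrFun h 1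
  simp [kmode] at h1

/-- `0 ∉ {e₂, −e₂}`. -/
theorem zero_not_mem_Smode : (0 : Fin 3 → ℤ) ∉ Smode := by
  simp only [Smode, Finset.mem_insert, Finset.mem_singleton, not_or]
  exact ⟨fun h => kmode_ne_zero h.symm, fun h => kmode_ne_zero (neg_eq_zero.mp h.symm)⟩

/-- `{e₂, −e₂}` is symmetric. -/
theorem Smode_symm : ∀ k ∈ Smode, -k ∈ Smode := by
  intro k hk
  simp only [Smode, Finset.mem_insert, Finset.mem_singleton] at hk ⊢
  rcases hk with rfl | rfl
  · exact Or.inr rfl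
  · exact Or.inl (neg_neg _)

/-- `e₂ ∈ {e₂, −e₂}`. -/
theorem kmode_mem_Smode : kmode ∈ Smode := by
  simp [Smode]

/-- The coefficient family is conjugate-symmetric (it is real and even). -/
theorem cmode_isConjSymm : IsConjSymm cmode := by
  intro k
  simp only [cmode]
  rw [EuclideanSpace.conjVec_complexify]

/-- The coefficient family is transversal: `k · ĉ_k = 0` on `{e₂, −e₂}` (the field is a shear). -/
theorem cmode_isTransversal : IsTransversal Smode cmode := by
  intro k hk
  simp only [Smode, Finset.mem_insert, Finset.mem_singleton] at hk
  rcases hk with rfl | rfl <;>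
    simp [cmode, kmode, Fin.sum_univ_three, EuclideanSpace.complexify_apply]

/-- The shear mode is an admissible datum: smooth, divergence free, zero mean. -/
theorem shearMode_isDatum : IsDatum shearMode :=
  ⟨isSmooth_realTrigPoly _ _, isDivFree_realTrigPoly cmode_isTransversal,
    Literature.Analysis.FluidPDE.hasZeroMean_realTrigPoly_of_zero_not_mem zero_not_mem_Smode _⟩

/-- The Fourier coefficient of the shear mode at `e₂` is `(1/2, 0, 0)`. -/
theorem mFourierCoeff_shearMode :
    mFourierCoeff (complexify ∘ shearMode) kmode = complexify (EuclideanSpace.single 0 (1 / 2 : ℝ)) := by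
  unfold shearMode
  rw [mFourierCoeff_realTrigPoly Smode_symm cmode_isConjSymm, if_pos kmode_mem_Smode]
  rfl

/-- Its norm is `1/2`. -/
theorem norm_mFourierCoeff_shearMode : ‖mFourierCoeff (complexify ∘ shearMode) kmode‖ = 1 / 2 := by
  rw [mFourierCoeff_shearMode, EuclideanSpace.norm_complexify]
  simp

/-- `|e₂|² = 1`. -/
theorem freqNormSq_kmode : freqNormSq kmode = 1 := by
  simp [freqNormSq, kmode, Fin.sum_univ_three]

/-- The paper's norm (6) of the shear mode: `‖u₀‖_n² ≥ (2π)^{2n} / 4` for every `n`. -/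
theorem normSq_shearMode_ge (n : ℕ) :
    ENNReal.ofReal ((2 * Real.pi) ^ (2 * n) / 4) ≤ normSq n shearMode := by
  have hterm := term_le_eHomSobolevSeminorm_sq (n : ℝ) (complexify ∘ shearMode) kmode_ne_zero
  rw [freqNormSq_kmode, Real.one_rpow, ENNReal.ofReal_one, one_mul] at hterm
  have hen : ‖mFourierCoeff (complexify ∘ shearMode) kmode‖ₑ ^ 2 = ENNReal.ofReal (1 / 4) := by
    rw [← ofReal_norm, norm_mFourierCoeff_shearMode, ← ENNReal.ofReal_pow (by norm_num)]
    norm_num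
  rw [hen] at hterm
  unfold normSq
  calc ENNReal.ofReal ((2 * Real.pi) ^ (2 * n) / 4)
      = ENNReal.ofReal ((2 * Real.pi) ^ (2 * n)) * ENNReal.ofReal (1 / 4) := by
        rw [← ENNReal.ofReal_mul (by positivity)]
        ring_nf
    _ ≤ ENNReal.ofReal ((2 * Real.pi) ^ (2 * n)) *
          eHomSobolevSeminorm (n : ℝ) (complexify ∘ shearMode) ^ 2 :=
        mul_le_mul' le_rfl hterm

/-- `(2π)^{2n} ≥ 16^n ≥ 1 + 15 n`. [folklore] -/
theorem one_add_mul_le_two_pi_pow (n : ℕ) : 1 + 15 * (n : ℝ) ≤ (2 * Real.pi) ^ (2 * n) := by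
  have hπ : (4 : ℝ) ≤ 2 * Real.pi := by linarith [Real.pi_gt_three]
  have h16 : (16 : ℝ) ^ n ≤ (2 * Real.pi) ^ (2 * n) := by
    rw [pow_mul]
    exact pow_le_pow_left₀ (by norm_num) (by nlinarith) n
  have hbern := one_add_mul_le_pow (show (-2 : ℝ) ≤ 15 by norm_num) n
  norm_num at hbern
  linarith

/-- **The Δ4 bridge is false (C24).** The shear mode `(cos 2πx₂, 0, 0)` is a smooth divergence-free
zero-mean datum on the unit box lying in no class (38): `‖u₀‖_n² ≥ (2π)^{2n}/4 → ∞`.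
Refutes `Literature.Claims.NS.Li2013b.Delta4` [refuted-substantive for the bridge as typed: the
printed Lemma 6 covers only the class (38), which is `{0}` (`dataClass38_eq_zero`); the abstract's
«any smooth initial condition» is a different, Clay-strength statement]. [folklore] -/
theorem not_Delta4 : ¬ Literature.Claims.NS.Li2013b.Delta4 := by
  intro h
  obtain ⟨K₃, hD⟩ := h shearMode shearMode_isDatum
  obtain ⟨n, hn⟩ := exists_nat_gt ((K₃ : ℝ) ^ 2)
  have h1 := (normSq_shearMode_ge n).trans (hD.2 n)
  rw [show ((K₃ : ℝ≥0∞)) ^ 2 = ENNReal.ofReal ((K₃ : ℝ) ^ 2) from by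
      rw [ENNReal.ofReal_pow K₃.coe_nonneg, ENNReal.ofReal_coe_nnreal],
    ENNReal.ofReal_le_ofReal_iff (by positivity)] at h1
  have h2 := one_add_mul_le_two_pi_pow n
  have h3 : (2 * Real.pi) ^ (2 * n) ≤ 4 * (K₃ : ℝ) ^ 2 := by
    have := (div_le_iff₀ (by norm_num : (0 : ℝ) < 4)).mp h1
    linarith
  have hn0 : (0 : ℝ) ≤ n := n.cast_nonneg
  linarith

/-! ## The data class (38) on zero-mean fields is `{0}` -/

/-- **(38) forces `u₀ = 0`.** If a smooth zero-mean field on the unit box has `‖u₀‖_m ≤ K₃` for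
every `m ∈ ℕ` in the norm (6), then `u₀ = 0`: each nonzero mode satisfies
`(2π)^{2m} |û_k|² ≤ K₃²` for all `m`, and the zero mode is the (vanishing) mean. [folklore] -/
theorem dataClass38_eq_zero {u₀ : UnitAddTorus (Fin 3) → EuclideanSpace ℝ (Fin 3)} {K₃ : ℝ≥0}
    (h : DataClass38 u₀ K₃) : u₀ = 0 := by
  obtain ⟨⟨hsm, -, hmean⟩, hK⟩ := h
  have hcont : Continuous u₀ := hsm.continuous
  have hint : Integrable u₀ volume := hcont.integrable_unitAddTorus
  have hcoef : ∀ k, mFourierCoeff (complexify ∘ u₀) k = 0 := by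
    intro k
    by_cases hk : k = 0
    · subst hk
      have h0 : mFourierCoeff (complexify ∘ u₀) 0 = ∫ x, complexify (u₀ x) := by
        rw [mFourierCoeff_eq_integral_volume]
        simp [mFourier_zero]
      have hL := complexify.toContinuousLinearMap.integral_comp_comm hint
      simp only [LinearIsometry.coe_toContinuousLinearMap] at hL
      rw [h0, hL, show (∫ x, u₀ x) = 0 from hmean, map_zero]
    · by_contra hne
      set a := ‖mFourierCoeff (complexify ∘ u₀) k‖ with ha
      have hpos : 0 < a := norm_pos_iff.mpr hne
      have hbound : ∀ n : ℕ, (2 * Real.pi) ^ (2 * n) * a ^ 2 ≤ (K₃ : ℝ) ^ 2 := by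
        intro n
        have hterm := term_le_eHomSobolevSeminorm_sq (n : ℝ) (complexify ∘ u₀) hk
        have hfreq : (1 : ℝ≥0∞) ≤ ENNReal.ofReal (freqNormSq k ^ (n : ℝ)) := by
          rw [← ENNReal.ofReal_one]
          exact ENNReal.ofReal_le_ofReal
            (Real.one_le_rpow (one_le_freqNormSq_of_ne_zero hk) n.cast_nonneg)
        have h2 : ‖mFourierCoeff (complexify ∘ u₀) k‖ₑ ^ 2 ≤
            eHomSobolevSeminorm (n : ℝ) (complexify ∘ u₀) ^ 2 := by
          have := mul_le_mul' hfreq (le_refl (‖mFourierCoeff (complexify ∘ u₀) k‖ₑ ^ 2))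
          rw [one_mul] at this
          exact this.trans hterm
        have h4 : ENNReal.ofReal ((2 * Real.pi) ^ (2 * n)) * ‖mFourierCoeff (complexify ∘ u₀) k‖ₑ ^ 2 ≤
            (K₃ : ℝ≥0∞) ^ 2 := by
          have h3 := hK n
          unfold normSq at h3
          exact (mul_le_mul' le_rfl h2).trans h3
        rw [← ofReal_norm, ← ha, ← ENNReal.ofReal_pow hpos.le, ← ENNReal.ofReal_mul (by positivity),
          show ((K₃ : ℝ≥0∞)) ^ 2 = ENNReal.ofReal ((K₃ : ℝ) ^ 2) from by
            rw [ENNReal.ofReal_pow K₃.coe_nonneg, ENNReal.ofReal_coe_nnreal],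
          ENNReal.ofReal_le_ofReal_iff (by positivity)] at h4
        exact h4
      obtain ⟨n, hn⟩ := exists_nat_gt ((K₃ : ℝ) ^ 2 / a ^ 2)
      have ha2 : 0 < a ^ 2 := by positivity
      rw [div_lt_iff₀ ha2] at hn
      have h5 := hbound n
      have h6 := one_add_mul_le_two_pi_pow n
      have h7 : (1 + 15 * (n : ℝ)) * a ^ 2 ≤ (2 * Real.pi) ^ (2 * n) * a ^ 2 :=
        mul_le_mul_of_nonneg_right h6 ha2.le
      have hn0 : (0 : ℝ) ≤ n := n.cast_nonneg
      nlinarith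
  have hzero := eq_zero_of_forall_mFourierCoeff_eq_zero (complexify.continuous.comp hcont) hcoef
  funext x
  have hx : complexify (u₀ x) = complexify 0 := by
    have := congrFun hzero x
    simpa using this
  exact EuclideanSpace.complexify_injective hx

/-! ## Lemma 6 as printed is true — vacuously -/

/-- The paper's norm (6) of the zero field vanishes. [folklore] -/
theorem normSq_zero_fun (l : ℕ) :
    normSq l (fun _ : UnitAddTorus (Fin 3) => (0 : EuclideanSpace ℝ (Fin 3))) = 0 := by
  unfold normSq
  have hc : (complexify ∘ fun _ : UnitAddTorus (Fin 3) => (0 : EuclideanSpace ℝ (Fin 3))) =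
      fun _ => (0 : EuclideanSpace ℂ (Fin 3)) := by
    funext x
    simp
  have hcoef : ∀ k : Fin 3 → ℤ,
      mFourierCoeff (fun _ : UnitAddTorus (Fin 3) => (0 : EuclideanSpace ℂ (Fin 3))) k = 0 := by
    intro k
    simp [mFourierCoeff]
  have hz : eHomSobolevSeminorm (l : ℝ) (fun _ : UnitAddTorus (Fin 3) => (0 : EuclideanSpace ℂ (Fin 3))) = 0 := by
    unfold eHomSobolevSeminorm
    simp only [hcoef, enorm_zero, ne_eq, OfNat.ofNat_ne_zero, not_false_eq_true, zero_pow, mul_zero,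
      tsum_zero]
    exact ENNReal.zero_rpow_of_pos (by norm_num)
  rw [hc, hz]
  simp

/-- The scalar norm (6) of the zero pressure vanishes. [folklore] -/
theorem normSqScalar_zero_fun (l : ℕ) :
    normSqScalar l (fun _ : UnitAddTorus (Fin 3) => (0 : ℝ)) = 0 := by
  unfold normSqScalar
  have hcoef : ∀ k : Fin 3 → ℤ, mFourierCoeff (fun _ : UnitAddTorus (Fin 3) => (0 : ℂ)) k = 0 := by
    intro k
    simp [mFourierCoeff]
  have hz : eHomSobolevSeminorm (l : ℝ) (fun _ : UnitAddTorus (Fin 3) => (0 : ℂ)) = 0 := by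
    unfold eHomSobolevSeminorm
    simp only [hcoef, enorm_zero, ne_eq, OfNat.ofNat_ne_zero, not_false_eq_true, zero_pow, mul_zero,
      tsum_zero]
    exact ENNReal.zero_rpow_of_pos (by norm_num)
  simp only [Complex.ofReal_zero]
  rw [hz]
  simp

/-- **Lemma 6 as printed holds, vacuously (C24).** Under (38) the datum is `0`
(`dataClass38_eq_zero`), and the zero flow with zero pressure is a smooth space-periodic solution
on `[0,T]` with all norms (6) equal to `0`. This is the typist's `ClaimedTheorem` (Lemma 6,
pp. 8–9, for the data class (38) p. 7) — true, and silent about every nonzero datum. [folklore] -/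
theorem claimedTheorem_holds : Literature.Claims.NS.Li2013b.ClaimedTheorem := by
  intro ν hν u₀ K₃ hD T hT
  have hu0 : u₀ = 0 := dataClass38_eq_zero hD
  subst hu0
  have hconst := Literature.Analysis.FluidPDE.isClassicalNSSolutionOn_const (d := Fin 3) ν
    (0 : EuclideanSpace ℝ (Fin 3))
  refine ⟨fun _ _ => 0, fun _ _ => 0, ⟨?_, rfl, ?_, ?_⟩, ⟨0, fun t _ l => ?_⟩, ⟨0, fun t _ l _ => ?_⟩⟩
  · exact hconst.mono (subset_univ _) (uniqueDiffOn_Icc hT)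
  · intro t _
    exact ⟨isSmooth_const _, hconst.divFree t (mem_univ t), by simp [HasZeroMean]⟩
  · intro t _
    simp [HasZeroMean]
  · rw [normSq_zero_fun]
    exact zero_le
  · rw [normSqScalar_zero_fun]
    exact zero_le

/-- **Step 6 (Proposition 5 ⇒ Lemma 6) holds** — trivially, since its conclusion
`ClaimedTheorem` does (`claimedTheorem_holds`). [folklore] -/
theorem step6_Lemma6_holds : Literature.Claims.NS.Li2013b.Step6_Lemma6 :=
  fun _ => claimedTheorem_holds

end Summit.NavierStokesRegularity.NavierStokesRegularity.Theorems.Li2013b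

end
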